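import Mathlib
import Literature.NumberTheory.LFunctions.MertensFormula
import Summits.Parity.BatemanHorn.Theorems.IsogenyRedeiSplitBlockJacobiSplitMassBound
import HarnessLib

/-!
# Smoothing the `t`-cutoff by counting (helper toward `stub_poissonReduction`, line
`cofactor-root-discrepancy`, crux `SplitBlockJacobi`, stmt-Parity-11583)

Let `A_q(x) = #{1 ≤ t ≤ x : q ∣ t² + 1}` and, for a weight `0 ≤ w ≤ 1` that equals `1` on
`[1, x]` outside a "bad" set `B ⊆ [1, x]`, let `A^w_q(x) = Σ_{t ≤ x, q ∣ t²+1} w(t)` and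
`W = Σ_{t ≤ x} w(t)`.  For any family `P` of pairs `(Q, Q′)` such that every `t ∈ [1, x]` has at
most `K` pairs of `P` with `QQ′ ∣ t² + 1`, and coefficients `|c| ≤ 1`,

`|Σ_P c·(A_{QQ′} − 4x/(QQ′)) − Σ_P c·(A^w_{QQ′} − 4W/(QQ′))| ≤ #B · (K + 4 Σ_P 1/(QQ′))`

(`smoothing_error_le`): each `t ∈ B` is charged at most `K` times, and `0 ≤ x − W ≤ #B`.
For the free pairs of the line (`Q < Q′` primes `> x^θ`, `θ > 1/2`) one may take `K = 25`
(`card_filter_mul_dvd_le` from the tree's `card_bigFactors_le_five`), and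
`Σ_{pairs} 1/(QQ′) ≤ 6` once `log x ≥ 32` (`sum_pairs_inv_le`, Mertens' theorem with rate).
-/

noncomputable section

open Finset

namespace Summit.Parity.BatemanHorn.Cruxes.SplitBlockJacobi.CofactorRootDiscrepancy.Poisson

open Literature.NumberTheory.LFunctions.Mertens
open Summit.Parity.BatemanHorn.Cruxes.SplitBlockJacobi.SplitMassMiddlePrime

/-! ### Double counting -/

/-- Double counting: `Σ_{q ∈ P} #{t ∈ B : R q t} = Σ_{t ∈ B} #{q ∈ P : R q t}`. -/
theorem sum_card_filter_comm {α β : Type*} (P : Finset α) (B : Finset β) (R : α → β → Prop)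
    [∀ a b, Decidable (R a b)] :
    ∑ q ∈ P, ((B.filter (fun t => R q t)).card : ℝ) =
      ∑ t ∈ B, ((P.filter (fun q => R q t)).card : ℝ) := by
  simp only [Finset.card_filter, Nat.cast_sum]
  rw [Finset.sum_comm]

/-! ### The smoothing inequality -/

/-- **Smoothing by counting.** See the module docstring. All sums are over `t ∈ [1, x]`. -/
theorem smoothing_error_le (x K : ℕ) (P : Finset (ℕ × ℕ))
    (hP : ∀ t ∈ Finset.Icc 1 x, (P.filter (fun q : ℕ × ℕ => q.1 * q.2 ∣ t ^ 2 + 1)).card ≤ K)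
    (hP0 : ∀ q ∈ P, 0 < q.1 * q.2)
    (c : ℕ × ℕ → ℝ) (hc : ∀ q ∈ P, |c q| ≤ 1) (w : ℕ → ℝ) (hw0 : ∀ t, 0 ≤ w t)
    (hw1 : ∀ t, w t ≤ 1) (B : Finset ℕ) (hB : B ⊆ Finset.Icc 1 x)
    (hwB : ∀ t ∈ Finset.Icc 1 x, t ∉ B → w t = 1) :
    |(∑ q ∈ P, c q * (((((Finset.Icc 1 x).filter (fun t : ℕ => q.1 * q.2 ∣ t ^ 2 + 1)).card : ℕ) : ℝ)
          - 4 * (x : ℝ) / ((q.1 * q.2 : ℕ) : ℝ))) -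
        ∑ q ∈ P, c q * ((∑ t ∈ (Finset.Icc 1 x).filter (fun t : ℕ => q.1 * q.2 ∣ t ^ 2 + 1), w t)
          - 4 * (∑ t ∈ Finset.Icc 1 x, w t) / ((q.1 * q.2 : ℕ) : ℝ))| ≤
      (B.card : ℝ) * (K + 4 * ∑ q ∈ P, (1 : ℝ) / ((q.1 * q.2 : ℕ) : ℝ)) := by
  -- the mass defect `x - W = Σ_{t ∈ B} (1 - w t) ∈ [0, #B]`
  set W : ℝ := ∑ t ∈ Finset.Icc 1 x, w t with hW
  have hdef : (x : ℝ) - W = ∑ t ∈ B, (1 - w t) := by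
    have hx : (x : ℝ) = ∑ t ∈ Finset.Icc 1 x, (1 : ℝ) := by simp
    rw [hx, hW, ← Finset.sum_sub_distrib]
    rw [← Finset.sum_subset hB]
    intro t ht htB
    rw [hwB t ht htB, sub_self]
  have hdef0 : 0 ≤ (x : ℝ) - W := by
    rw [hdef]; exact Finset.sum_nonneg fun t _ => sub_nonneg.mpr (hw1 t)
  have hdefB : (x : ℝ) - W ≤ B.card := by
    rw [hdef]
    calc ∑ t ∈ B, (1 - w t) ≤ ∑ t ∈ B, (1 : ℝ) :=
          Finset.sum_le_sum fun t _ => by linarith [hw0 t]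
      _ = B.card := by simp
  -- per-pair defect `D_q = Σ_{t ≤ x, q ∣ t²+1} (1 - w t) ∈ [0, #{t ∈ B : q ∣ t²+1}]`
  have hD : ∀ q ∈ P,
      (((((Finset.Icc 1 x).filter (fun t : ℕ => q.1 * q.2 ∣ t ^ 2 + 1)).card : ℕ) : ℝ) -
          ∑ t ∈ (Finset.Icc 1 x).filter (fun t : ℕ => q.1 * q.2 ∣ t ^ 2 + 1), w t) =
        ∑ t ∈ B.filter (fun t : ℕ => q.1 * q.2 ∣ t ^ 2 + 1), (1 - w t) := by
    intro q _
    have hc : ((((Finset.Icc 1 x).filter (fun t : ℕ => q.1 * q.2 ∣ t ^ 2 + 1)).card : ℕ) : ℝ) =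
        ∑ t ∈ (Finset.Icc 1 x).filter (fun t : ℕ => q.1 * q.2 ∣ t ^ 2 + 1), (1 : ℝ) := by simp
    rw [hc, ← Finset.sum_sub_distrib]
    symm
    apply Finset.sum_subset (Finset.filter_subset_filter _ hB)
    intro t ht htB
    rw [Finset.mem_filter] at ht
    have htB' : t ∉ B := fun h => htB (Finset.mem_filter.mpr ⟨h, ht.2⟩)
    rw [hwB t ht.1 htB', sub_self]
  have hD0 : ∀ q ∈ P, 0 ≤ ∑ t ∈ B.filter (fun t : ℕ => q.1 * q.2 ∣ t ^ 2 + 1), (1 - w t) :=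
    fun q _ => Finset.sum_nonneg fun t _ => sub_nonneg.mpr (hw1 t)
  have hD1 : ∀ q ∈ P, ∑ t ∈ B.filter (fun t : ℕ => q.1 * q.2 ∣ t ^ 2 + 1), (1 - w t) ≤
      ((B.filter (fun t : ℕ => q.1 * q.2 ∣ t ^ 2 + 1)).card : ℝ) := by
    intro q _
    calc ∑ t ∈ B.filter (fun t : ℕ => q.1 * q.2 ∣ t ^ 2 + 1), (1 - w t)
        ≤ ∑ t ∈ B.filter (fun t : ℕ => q.1 * q.2 ∣ t ^ 2 + 1), (1 : ℝ) :=
          Finset.sum_le_sum fun t _ => by linarith [hw0 t]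
      _ = _ := by simp
  -- rewrite the difference pairwise
  rw [← Finset.sum_sub_distrib]
  have hterm : ∀ q ∈ P,
      c q * (((((Finset.Icc 1 x).filter (fun t : ℕ => q.1 * q.2 ∣ t ^ 2 + 1)).card : ℕ) : ℝ)
          - 4 * (x : ℝ) / ((q.1 * q.2 : ℕ) : ℝ)) -
        c q * ((∑ t ∈ (Finset.Icc 1 x).filter (fun t : ℕ => q.1 * q.2 ∣ t ^ 2 + 1), w t)
          - 4 * W / ((q.1 * q.2 : ℕ) : ℝ)) =
      c q * ((∑ t ∈ B.filter (fun t : ℕ => q.1 * q.2 ∣ t ^ 2 + 1), (1 - w t)) -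
        4 * ((x : ℝ) - W) / ((q.1 * q.2 : ℕ) : ℝ)) := by
    intro q hq
    rw [← hD q hq]
    ring
  rw [Finset.sum_congr rfl hterm]
  -- bound each term
  have hbound : ∀ q ∈ P,
      |c q * ((∑ t ∈ B.filter (fun t : ℕ => q.1 * q.2 ∣ t ^ 2 + 1), (1 - w t)) -
        4 * ((x : ℝ) - W) / ((q.1 * q.2 : ℕ) : ℝ))| ≤
      ((B.filter (fun t : ℕ => q.1 * q.2 ∣ t ^ 2 + 1)).card : ℝ) +
        (B.card : ℝ) * (4 * (1 / ((q.1 * q.2 : ℕ) : ℝ))) := by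
    intro q hq
    have hq0 : (0 : ℝ) < ((q.1 * q.2 : ℕ) : ℝ) := by exact_mod_cast hP0 q hq
    rw [abs_mul]
    have h1 : |(∑ t ∈ B.filter (fun t : ℕ => q.1 * q.2 ∣ t ^ 2 + 1), (1 - w t)) -
        4 * ((x : ℝ) - W) / ((q.1 * q.2 : ℕ) : ℝ)| ≤
        ((B.filter (fun t : ℕ => q.1 * q.2 ∣ t ^ 2 + 1)).card : ℝ) +
          (B.card : ℝ) * (4 * (1 / ((q.1 * q.2 : ℕ) : ℝ))) := by
      refine (abs_sub _ _).trans (add_le_add ?_ ?_)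
      · rw [abs_of_nonneg (hD0 q hq)]; exact hD1 q hq
      · rw [abs_of_nonneg (by positivity)]
        have h := div_le_div_of_nonneg_right hdefB hq0.le
        calc 4 * ((x : ℝ) - W) / ((q.1 * q.2 : ℕ) : ℝ) = 4 * (((x : ℝ) - W) / ((q.1 * q.2 : ℕ) : ℝ)) := by
              ring
          _ ≤ 4 * ((B.card : ℝ) / ((q.1 * q.2 : ℕ) : ℝ)) := by linarith
          _ = _ := by ring
    calc |c q| * _ ≤ 1 * _ := mul_le_mul (hc q hq) h1 (abs_nonneg _) zero_le_one
      _ = _ := one_mul _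
  refine (Finset.abs_sum_le_sum_abs _ _).trans ((Finset.sum_le_sum hbound).trans ?_)
  rw [Finset.sum_add_distrib, sum_card_filter_comm, ← Finset.mul_sum, ← Finset.mul_sum,
    mul_add]
  refine add_le_add ?_ le_rfl
  calc ∑ t ∈ B, ((P.filter (fun q : ℕ × ℕ => q.1 * q.2 ∣ t ^ 2 + 1)).card : ℝ)
      ≤ ∑ t ∈ B, (K : ℝ) := Finset.sum_le_sum fun t ht => by exact_mod_cast hP t (hB ht)
    _ = (B.card : ℝ) * K := by rw [Finset.sum_const, nsmul_eq_mul]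

/-! ### At most `25` free pairs divide a given `t² + 1` -/

/-- For `θ > 1/2`, `x ≥ 2`, `1 ≤ t ≤ x`: among pairs of primes `(Q, Q′)` with `x^θ < Q < Q′`,
at most `25` satisfy `QQ′ ∣ t² + 1` (there are at most five prime factors `> x^θ`). -/
theorem card_filter_mul_dvd_le {θ : ℝ} (hθ : 1 / 2 < θ) {x : ℕ} (hx : 2 ≤ x)
    (P : Finset (ℕ × ℕ))
    (hP : ∀ q ∈ P, q.1.Prime ∧ q.2.Prime ∧ (x : ℝ) ^ θ < (q.1 : ℝ) ∧ q.1 < q.2)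
    (t : ℕ) (ht : t ∈ Finset.Icc 1 x) :
    (P.filter (fun q : ℕ × ℕ => q.1 * q.2 ∣ t ^ 2 + 1)).card ≤ 25 := by
  set F := (t ^ 2 + 1).primeFactors.filter (fun p : ℕ => (x : ℝ) ^ θ < p) with hF
  have hF5 : F.card ≤ 5 := card_bigFactors_le_five hθ hx ht
  have hsub : P.filter (fun q : ℕ × ℕ => q.1 * q.2 ∣ t ^ 2 + 1) ⊆ F ×ˢ F := by
    intro q hq
    rw [Finset.mem_filter] at hq
    obtain ⟨hqP, hdvd⟩ := hq
    obtain ⟨h1, h2, hθ1, h12⟩ := hP q hqP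
    have hne : t ^ 2 + 1 ≠ 0 := Nat.succ_ne_zero _
    have hθ2 : (x : ℝ) ^ θ < q.2 := hθ1.trans (by exact_mod_cast h12)
    rw [Finset.mem_product, hF, Finset.mem_filter, Finset.mem_filter, Nat.mem_primeFactors,
      Nat.mem_primeFactors]
    exact ⟨⟨⟨h1, (Dvd.intro _ rfl).trans hdvd, hne⟩, hθ1⟩,
      ⟨⟨h2, (Dvd.intro_left _ rfl).trans hdvd, hne⟩, hθ2⟩⟩
  calc (P.filter (fun q : ℕ × ℕ => q.1 * q.2 ∣ t ^ 2 + 1)).card ≤ (F ×ˢ F).card :=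
        Finset.card_le_card hsub
    _ = F.card * F.card := Finset.card_product _ _
    _ ≤ 5 * 5 := Nat.mul_le_mul hF5 hF5

/-! ### `Σ_{pairs} 1/(QQ′)` is bounded (Mertens) -/

/-- Mertens with rate on an interval: for `2 ≤ a ≤ b`,
`Σ_{a < p ≤ b} 1/p ≤ log log b − log log a + 8/log b + 8/log a`. -/
theorem sum_inv_primes_Ioc_le {a b : ℝ} (ha : 2 ≤ a) (hab : a ≤ b) :
    ∑ p ∈ Nat.primesLE ⌊b⌋₊ \ Nat.primesLE ⌊a⌋₊, (p : ℝ)⁻¹ ≤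
      Real.log (Real.log b) - Real.log (Real.log a) + 8 / Real.log b + 8 / Real.log a := by
  have hb : 2 ≤ b := ha.trans hab
  have hsub : Nat.primesLE ⌊a⌋₊ ⊆ Nat.primesLE ⌊b⌋₊ := Nat.primesLE_mono (Nat.floor_le_floor hab)
  rw [Finset.sum_sdiff_eq_sub hsub]
  have h1 := (abs_le.mp (abs_primeRecipSum_sub_le hb)).2
  have h2 := (abs_le.mp (abs_primeRecipSum_sub_le ha)).1
  have e1 : primeRecipSum b = ∑ p ∈ Nat.primesLE ⌊b⌋₊, (p : ℝ)⁻¹ := rfl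
  have e2 : primeRecipSum a = ∑ p ∈ Nat.primesLE ⌊a⌋₊, (p : ℝ)⁻¹ := rfl
  rw [← e1, ← e2]
  linarith

/-- **`Σ_{(Q,Q′) free pair} 1/(QQ′) ≤ 12`** for `1/2 < θ < 1` and `log x ≥ 32`: the pairs lie in
`(x^θ, x] × (x^θ, x²+1]` and Mertens' theorem bounds the two factors by `2` and `6`. -/
theorem sum_pairs_inv_le {θ : ℝ} (hθ : 1 / 2 < θ) (hθ1 : θ < 1) {x : ℕ}
    (hx : (32 : ℝ) ≤ Real.log x) :
    ∑ q ∈ (Finset.range (x ^ 2 + 2) ×ˢ Finset.range (x ^ 2 + 2)).filter (fun q : ℕ × ℕ =>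
        q.1.Prime ∧ q.2.Prime ∧ q.1 % 4 = 1 ∧ q.2 % 4 = 1 ∧ (x : ℝ) ^ θ < (q.1 : ℝ) ∧
          q.1 < q.2 ∧ q.1 * q.2 ≤ x ^ 2 + 1),
      (1 : ℝ) / ((q.1 * q.2 : ℕ) : ℝ) ≤ 12 := by
  have hθ0 : 0 < θ := by linarith
  -- size facts about `x`
  have hx1 : (1 : ℝ) < x := by
    by_contra h
    push Not at h
    have hx0 : (0 : ℝ) ≤ x := Nat.cast_nonneg x
    have : Real.log x ≤ 0 := Real.log_nonpos hx0 h
    linarith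
  have hx0 : (0 : ℝ) < x := by linarith
  have hlogx : 0 < Real.log x := Real.log_pos hx1
  have hx2 : (2 : ℝ) ≤ x := by
    by_contra h
    push Not at h
    have : Real.log x < Real.log 2 := Real.log_lt_log hx0 h
    have h2 : Real.log 2 < 1 := by
      have := Real.log_two_lt_d9; norm_num at this; linarith
    linarith
  have hxN2 : 2 ≤ x := by exact_mod_cast hx2
  have hlogθ : Real.log ((x : ℝ) ^ θ) = θ * Real.log x := Real.log_rpow hx0 θ
  -- `x^θ ≥ 2`: `log x^θ = θ log x ≥ 16 > log 2`
  have hxθ2 : (2 : ℝ) ≤ (x : ℝ) ^ θ := by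
    by_contra h
    push Not at h
    have hpos : 0 < (x : ℝ) ^ θ := Real.rpow_pos_of_pos hx0 θ
    have h' : Real.log ((x : ℝ) ^ θ) < Real.log 2 := Real.log_lt_log hpos h
    have h2 : Real.log 2 < 1 := by
      have := Real.log_two_lt_d9; norm_num at this; linarith
    rw [hlogθ] at h'
    nlinarith
  have hxθx : (x : ℝ) ^ θ ≤ x := by
    calc (x : ℝ) ^ θ ≤ (x : ℝ) ^ (1 : ℝ) := Real.rpow_le_rpow_of_exponent_le hx1.le hθ1.le
      _ = x := Real.rpow_one _
  have hb : (x : ℝ) ^ θ ≤ ((x ^ 2 + 1 : ℕ) : ℝ) := by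
    refine hxθx.trans ?_
    exact_mod_cast (by nlinarith : x ≤ x ^ 2 + 1)
  -- the two one-dimensional sums
  set S₁ := Nat.primesLE x \ Nat.primesLE ⌊(x : ℝ) ^ θ⌋₊ with hS₁
  set S₂ := Nat.primesLE ⌊((x ^ 2 + 1 : ℕ) : ℝ)⌋₊ \ Nat.primesLE ⌊(x : ℝ) ^ θ⌋₊ with hS₂
  have h1 : ∑ p ∈ S₁, (p : ℝ)⁻¹ ≤ 2 := by
    have h := sum_inv_primes_sdiff_le hθ hθ1 hxθ2
    have : 24 / Real.log x ≤ 1 := by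
      rw [div_le_one hlogx]; linarith
    rw [hS₁]
    linarith
  have h2 : ∑ p ∈ S₂, (p : ℝ)⁻¹ ≤ 6 := by
    have h := sum_inv_primes_Ioc_le hxθ2 hb
    -- `log log (x²+1) - log log x^θ ≤ log(x²+1)/(θ log x) - 1 ≤ 3/θ - 1 ≤ 5`
    have hb1 : (1 : ℝ) < ((x ^ 2 + 1 : ℕ) : ℝ) := by push_cast; nlinarith
    have hlogb : 0 < Real.log ((x ^ 2 + 1 : ℕ) : ℝ) := Real.log_pos hb1
    have hlogb3 : Real.log ((x ^ 2 + 1 : ℕ) : ℝ) ≤ 3 * Real.log x := by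
      have h3 : ((x ^ 2 + 1 : ℕ) : ℝ) ≤ (x : ℝ) ^ (3 : ℕ) := by
        push_cast
        nlinarith
      calc Real.log ((x ^ 2 + 1 : ℕ) : ℝ) ≤ Real.log ((x : ℝ) ^ (3 : ℕ)) :=
            Real.log_le_log (by positivity) h3
        _ = 3 * Real.log x := by rw [Real.log_pow]; norm_num
    have hlθ : 0 < Real.log ((x : ℝ) ^ θ) := by rw [hlogθ]; positivity
    have hdiff : Real.log (Real.log ((x ^ 2 + 1 : ℕ) : ℝ)) - Real.log (Real.log ((x : ℝ) ^ θ)) ≤ 5 := by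
      rw [← Real.log_div hlogb.ne' hlθ.ne']
      refine (Real.log_le_sub_one_of_pos (div_pos hlogb hlθ)).trans ?_
      rw [hlogθ]
      have hθ3 : Real.log ((x ^ 2 + 1 : ℕ) : ℝ) / (θ * Real.log x) ≤ 6 := by
        rw [div_le_iff₀ (by positivity)]
        nlinarith
      linarith
    have hr1 : 8 / Real.log ((x ^ 2 + 1 : ℕ) : ℝ) ≤ 1 / 2 := by
      rw [div_le_iff₀ hlogb]
      have : Real.log x ≤ Real.log ((x ^ 2 + 1 : ℕ) : ℝ) :=
        Real.log_le_log hx0 (by push_cast; nlinarith)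
      linarith
    have hr2 : 8 / Real.log ((x : ℝ) ^ θ) ≤ 1 / 2 := by
      rw [hlogθ, div_le_iff₀ (by positivity)]
      nlinarith
    rw [hS₂]
    linarith
  -- the pair set embeds into `S₁ × S₂`
  have hsub : (Finset.range (x ^ 2 + 2) ×ˢ Finset.range (x ^ 2 + 2)).filter (fun q : ℕ × ℕ =>
        q.1.Prime ∧ q.2.Prime ∧ q.1 % 4 = 1 ∧ q.2 % 4 = 1 ∧ (x : ℝ) ^ θ < (q.1 : ℝ) ∧
          q.1 < q.2 ∧ q.1 * q.2 ≤ x ^ 2 + 1) ⊆ S₁ ×ˢ S₂ := by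
    intro q hq
    rw [Finset.mem_filter] at hq
    obtain ⟨-, hp1, hp2, -, -, hθq, h12, hle⟩ := hq
    have hfl : ⌊(x : ℝ) ^ θ⌋₊ < q.1 := (Nat.floor_lt (by positivity)).mpr hθq
    have hq1x : q.1 ≤ x := by
      have : q.1 * q.1 < x ^ 2 + 1 + 1 := by nlinarith
      nlinarith
    rw [Finset.mem_product, hS₁, hS₂, Finset.mem_sdiff, Finset.mem_sdiff, Nat.mem_primesLE,
      Nat.mem_primesLE, Nat.mem_primesLE, Nat.mem_primesLE, Nat.floor_natCast]
    refine ⟨⟨⟨hq1x, hp1⟩, fun h => ?_⟩, ⟨⟨?_, hp2⟩, fun h => ?_⟩⟩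
    · omega
    · nlinarith [hp1.one_lt]
    · omega
  have hnn : ∀ q ∈ S₁ ×ˢ S₂, (0 : ℝ) ≤ 1 / ((q.1 * q.2 : ℕ) : ℝ) := fun q _ => by positivity
  refine (Finset.sum_le_sum_of_subset_of_nonneg hsub fun q hq _ => hnn q hq).trans ?_
  rw [Finset.sum_product]
  have hfac : ∑ a ∈ S₁, ∑ b ∈ S₂, (1 : ℝ) / (((a, b).1 * (a, b).2 : ℕ) : ℝ) =
      (∑ a ∈ S₁, (a : ℝ)⁻¹) * ∑ b ∈ S₂, (b : ℝ)⁻¹ := by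
    rw [Finset.sum_mul_sum]
    refine Finset.sum_congr rfl fun a _ => Finset.sum_congr rfl fun b _ => ?_
    push_cast
    rw [one_div, mul_inv]
  rw [hfac]
  have h1nn : 0 ≤ ∑ a ∈ S₁, (a : ℝ)⁻¹ := Finset.sum_nonneg fun a _ => by positivity
  have h2nn : 0 ≤ ∑ b ∈ S₂, (b : ℝ)⁻¹ := Finset.sum_nonneg fun b _ => by positivity
  nlinarith [mul_le_mul h1 h2 h2nn (by norm_num : (0 : ℝ) ≤ 2)]

end Summit.Parity.BatemanHorn.Cruxes.SplitBlockJacobi.CofactorRootDiscrepancy.Poisson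

namespace Summit.Parity.BatemanHorn.Cruxes.SplitBlockJacobi.CofactorRootDiscrepancy

/-- **Registered stub form** of `Poisson.smoothing_error_le`: the identical statement, declared in the crux
namespace under the name registered on stmt-Parity-11583 (`ledger workitem stub-add`). -/
theorem smoothing_error_le :
    ∀ (x K : ℕ) (P : Finset (ℕ × ℕ)) (hP : ∀ t ∈ Finset.Icc 1 x, (P.filter (fun q : ℕ × ℕ => q.1 * q.2 ∣ t ^ 2 + 1)).card ≤ K) (hP0 : ∀ q ∈ P, 0 < q.1 * q.2) (c : ℕ × ℕ → ℝ) (hc : ∀ q ∈ P, |c q| ≤ 1) (w : ℕ → ℝ) (hw0 : ∀ t, 0 ≤ w t) (hw1 : ∀ t, w t ≤ 1) (B : Finset ℕ) (hB : B ⊆ Finset.Icc 1 x) (hwB : ∀ t ∈ Finset.Icc 1 x, t ∉ B → w t = 1), |(∑ q ∈ P, c q * (((((Finset.Icc 1 x).filter (fun t : ℕ => q.1 * q.2 ∣ t ^ 2 + 1)).card : ℕ) : ℝ) - 4 * (x : ℝ) / ((q.1 * q.2 : ℕ) : ℝ))) - ∑ q ∈ P, c q * ((∑ t ∈ (Finset.Icc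 1 x).filter (fun t : ℕ => q.1 * q.2 ∣ t ^ 2 + 1), w t) - 4 * (∑ t ∈ Finset.Icc 1 x, w t) / ((q.1 * q.2 : ℕ) : ℝ))| ≤ (B.card : ℝ) * (K + 4 * ∑ q ∈ P, (1 : ℝ) / ((q.1 * q.2 : ℕ) : ℝ)) :=
  @Poisson.smoothing_error_le

end Summit.Parity.BatemanHorn.Cruxes.SplitBlockJacobi.CofactorRootDiscrepancy

end
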